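import Literature.Barriers.FinalStateConjecture.KleinGordonSuperradiantInstabilityReduced
import Literature.Geometry.Lorentzian.KerrStarCoord
import Literature.Geometry.Lorentzian.KerrHyperboloidalFlux
import Mathlib.Analysis.Calculus.Deriv.Inv
import Mathlib.Analysis.Calculus.FDeriv.Pow
import Mathlib.Analysis.Calculus.MeanValue
import Mathlib.Analysis.Complex.RealDeriv
import Mathlib.Analysis.SpecialFunctions.ExpDeriv
import HarnessLib

/-!
# Barrier catalogue `FinalStateConjecture`: Shlapentokh-Rothman's superradiant instability —
# analytic inputs for separating the reduced Kerr wave operator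

Theorems (no new definitions) feeding the separation of variables which reduces the profile form
`ShlapentokhRothman2014_unstableModeProfile` of Shlapentokh-Rothman's mode theorem (CMP 329 (2014),
Thm. 1.2) to the printed ODEs (sibling file `…Separation.lean`):

* `reducedWaveOp_kerrStar` — **the reduced Kerr wave operator `P_ω` in Kerr's ingoing spheroidal
  coordinates** `Y_a(r, θ, φ)` of the leaf (`KerrStarCoord.lean`): with `F = Φ ∘ Y_a` and
  `Σ = r² + a² cos² θ`,
  `Σ P_ω Φ = ∂_r((r² + a²)∂_r F) − 2M∂_r F − 2Mr ∂_r² F + (sin θ)⁻¹∂_θ(sin θ ∂_θ F) + (sin² θ)⁻¹∂_φ² F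
   + a(∂_r∂_φ + ∂_φ∂_r)F + ω²(Σ + 2Mr)F − 4iωMr ∂_r F − 2iωM F`
  — the Kerr-star form of `□_g` (SR §1.2.1) with `∂_{t*} ↦ −iω`, from `reducedWaveOp_eq`
  (`ℓ⃗ = n̂ = ∂_r Y_a`, `H = Mr/Σ`) and `Kerr.laplacian_kerrStar`;
* `ingoingRadial_of_radialODE` — **conjugation of the printed radial ODE (2.2) to the ingoing chart**:
  if `R` solves `Δ(ΔR')' − V R = 0` and `R = e^{−i(ωt̄ − mφ̄)} f` ((2.3); `dt̄/dr = (r² + a²)/Δ`,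
  `dφ̄/dr = a/Δ`, §1.2.1), then `u = e^{−iωr} f` solves
  `Δu'' + Δ'u' + (2iam − 4iωMr)u' + (ω²(r² + 2Mr) − 2iωM − λ − μ²r²)u = 0`
  (`u = e^{iχ}R` with `Δχ' = 2Mωr − am`), plus `deriv_sin_mul_deriv` (expanded angular operator);
* `ingoing_bounds` — `|u|, |u'| ≤ C₁ e^{−κr}` on `(r₊, ∞)` from the horizon regularity of `f`, the
  exponential decay of `R`, `R'` at infinity, `Im ω > 0` and the monotonicity of `t̄ − r`
  (`d(t̄ − r)/dr = 2Mr/Δ ≥ 0`), with `|κ| = |(2Mωr − am)/Δ| ≤ 2M|ω|(1 + r₊) + |am|` on `[r₊ + 1, ∞)`;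
* geometric bounds on the leaf: `|∇r| ≤ 1 + |a|/r` (`norm_radiusGrad_le`), a uniform bound for the
  differential of `y ↦ ℓ⃗(0, y)` on `{r ≥ ρ}` (`exists_bound_fderiv_nullSpatial`), bounds for a smooth
  function and its differential on the unit sphere (`sphere_bounds`), `e^{−κr} ≤ e^{κ|a|}e^{−κ‖y‖}`.

## References
* Y. Shlapentokh-Rothman, CMP 329 (2014) 859–891, §1.2.1 (Kerr-star coordinates, `t̄`, `φ̄`), §2
  ((2.1)–(2.5)), third appendix (key `ShlapentokhRothman2014KleinGordon`).
* R. P. Kerr, A. Schild (1965), §2; M. Visser, arXiv:0706.0622, (33)–(35), §4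
  (keys `KerrSchild1965`, `arXiv07060622`).
-/

noncomputable section

open Set Filter Topology Real Metric Laplacian
open scoped ContDiff

namespace Literature.Barriers.FinalStateConjecture

open Literature.Geometry.Lorentzian Literature.Geometry.Lorentzian.Kerr

/-! ### The reduced Kerr wave operator in Kerr's ingoing spheroidal coordinates -/

/-- `∂_r F = DΦ(y)(n̂)` for `F(s) = Φ(Y_a(s, θ, φ))`, `y = Y_a(r, θ, φ)`. [folklore] -/
theorem deriv_comp_kerrStar_r {Φ : E3 → ℂ} {a r θ φ : ℝ}
    (hΦ : DifferentiableAt ℝ Φ (kerrStar a r θ φ)) :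
    deriv (fun s ↦ Φ (kerrStar a s θ φ)) r = fderiv ℝ Φ (kerrStar a r θ φ) (sphRadial θ φ) :=
  (hasDerivAt_comp_curve (γ := fun s ↦ kerrStar a s θ φ) (t₀ := r) hΦ (hasDerivAt_kerrStar_r a r θ φ)).deriv

/-- `∂_r ∂_r F = D²Φ(y)(n̂, n̂)` for `F(s) = Φ(Y_a(s, θ, φ))`, `y = Y_a(r, θ, φ)`, `Φ` of class `C²`
at `y` (the `r`-lines are straight with velocity `n̂`). [folklore] -/
theorem deriv_deriv_comp_kerrStar_r {Φ : E3 → ℂ} {a r θ φ : ℝ}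
    (hΦ : ContDiffAt ℝ 2 Φ (kerrStar a r θ φ)) :
    deriv (deriv (fun s ↦ Φ (kerrStar a s θ φ))) r =
      fderiv ℝ (fderiv ℝ Φ) (kerrStar a r θ φ) (sphRadial θ φ) (sphRadial θ φ) := by
  have hΦ2 : DifferentiableAt ℝ (fderiv ℝ Φ) (kerrStar a r θ φ) :=
    (hΦ.fderiv_right (m := 1) le_rfl).differentiableAt (by simp)
  have hev := deriv_comp_curve_eventuallyEq (γ := fun s ↦ kerrStar a s θ φ) (t₀ := r) hΦ
    (hasDerivAt_kerrStar_r a r θ φ).continuousAt (fun s ↦ hasDerivAt_kerrStar_r a s θ φ)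
  rw [hev.deriv_eq]
  have h := (hasDerivAt_fderiv_comp_curve (γ := fun s ↦ kerrStar a s θ φ) (t₀ := r) hΦ2
    (hasDerivAt_kerrStar_r a r θ φ) (hasDerivAt_const r (sphRadial θ φ))).deriv
  rw [map_zero, add_zero] at h
  exact h

/-- **The reduced Kerr wave operator in Kerr's ingoing spheroidal coordinates.** Let `Φ : E3 → ℂ`
be `C²` at `y = Y_a(r, θ, φ)`, `r > 0`, `sin θ ≠ 0`, and `F(s, t, p) = Φ(Y_a(s, t, p))`. Then, with
`Σ = r² + a² cos² θ`,
`Σ · P_ω Φ(y) = ∂_r((r² + a²)∂_r F) − 2M ∂_r F − 2Mr ∂_r∂_r F + (sin θ)⁻¹ ∂_θ(sin θ ∂_θ F)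
  + (sin² θ)⁻¹ ∂_φ∂_φ F + a(∂_r∂_φ F + ∂_φ∂_r F) + ω²(Σ + 2Mr) F − 4iωMr ∂_r F − 2iωM F`
(note `∂_r((r² + a²)∂_r F) − 2M∂_r F − 2Mr∂_r² F = ∂_r(Δ ∂_r F)`, `Δ = r² − 2Mr + a²`): the
stationary Kerr wave operator `ρ² e^{iωt_KS} □_g (e^{−iωt_KS} F)` in the chart
`(t_KS, r, θ, φ_KS) = (t* − r, r, θ, φ*)`, i.e. the Kerr-star form of `□_g` (SR, CMP 329 (2014),
§1.2.1) with `∂_{t*} ↦ −iω`, `∂_r|_{t*} ↦ ∂_r + iω`. From `reducedWaveOp_eq` (`ℓ⃗(y) = n̂ = ∂_r Y_a`,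
`H = Mr/Σ`) and the flat Laplacian in these coordinates (`Kerr.laplacian_kerrStar`).
[cite: ShlapentokhRothman2014KleinGordon, §1.2.1 and §2] -/
theorem reducedWaveOp_kerrStar {M a : ℝ} (w : ℂ) {Φ : E3 → ℂ} {r θ φ : ℝ} (hr : 0 < r)
    (hθ : sin θ ≠ 0) (hΦ : ContDiffAt ℝ 2 Φ (kerrStar a r θ φ)) :
    ((r ^ 2 + a ^ 2 * cos θ ^ 2 : ℝ) : ℂ) * reducedWaveOp M a w Φ (kerrStar a r θ φ) =
      deriv (fun s ↦ (s ^ 2 + a ^ 2) • deriv (fun s' ↦ Φ (kerrStar a s' θ φ)) s) r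
      - 2 * (M : ℂ) * deriv (fun s ↦ Φ (kerrStar a s θ φ)) r
      - 2 * (M : ℂ) * r * deriv (deriv (fun s ↦ Φ (kerrStar a s θ φ))) r
      + (sin θ)⁻¹ • deriv (fun t ↦ sin t • deriv (fun t' ↦ Φ (kerrStar a r t' φ)) t) θ
      + (sin θ ^ 2)⁻¹ • deriv (fun p ↦ deriv (fun p' ↦ Φ (kerrStar a r θ p')) p) φ
      + a • (deriv (fun s ↦ deriv (fun p ↦ Φ (kerrStar a s θ p)) φ) r +
          deriv (fun p ↦ deriv (fun s ↦ Φ (kerrStar a s θ p)) r) φ)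
      + w ^ 2 * ((r ^ 2 + a ^ 2 * cos θ ^ 2 : ℝ) + 2 * M * r : ℂ) * Φ (kerrStar a r θ φ)
      - 4 * (Complex.I * w) * M * r * deriv (fun s ↦ Φ (kerrStar a s θ φ)) r
      - 2 * (Complex.I * w) * M * Φ (kerrStar a r θ φ) := by
  have hry : 0 < Kerr.radius a (E4.ofTimeSpace 0 (kerrStar a r θ φ)) := by rwa [radius_kerrStar a hr]
  have hSig : (0 : ℝ) < r ^ 2 + a ^ 2 * cos θ ^ 2 := sq_add_sq_mul_cos_sq_pos a hr.ne' θ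
  have hP := reducedWaveOp_eq (M := M) w hry hΦ
  have hL := laplacian_kerrStar (F := ℂ) (a := a) (r := r) hθ hΦ
  rw [nullSpatial_kerrStar a hr, scalarH_kerrStar M a hr, blSigma_kerrStar a hr,
    ← deriv_comp_kerrStar_r (hΦ.differentiableAt (by simp)), ← deriv_deriv_comp_kerrStar_r hΦ] at hP
  rw [hP]
  -- replace `Σ ΔΦ` by the coordinate expression
  have hL' : ((r ^ 2 + a ^ 2 * cos θ ^ 2 : ℝ) : ℂ) * Δ Φ (kerrStar a r θ φ) =
      deriv (fun s ↦ (s ^ 2 + a ^ 2) • deriv (fun s' ↦ Φ (kerrStar a s' θ φ)) s) r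
      + (sin θ)⁻¹ • deriv (fun t ↦ sin t • deriv (fun t' ↦ Φ (kerrStar a r t' φ)) t) θ
      + (sin θ ^ 2)⁻¹ • deriv (fun p ↦ deriv (fun p' ↦ Φ (kerrStar a r θ p')) p) φ
      + a • (deriv (fun s ↦ deriv (fun p ↦ Φ (kerrStar a s θ p)) φ) r +
          deriv (fun p ↦ deriv (fun s ↦ Φ (kerrStar a s θ p)) r) φ) := by
    rw [← Complex.real_smul, hL]
  have hSC : ((r ^ 2 + a ^ 2 * cos θ ^ 2 : ℝ) : ℂ) ≠ 0 := by exact_mod_cast hSig.ne'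
  rw [mul_add, hL']
  simp only [Complex.ofReal_div, Complex.ofReal_mul] at hSC ⊢
  field_simp
  ring

/-! ### The printed ODEs: expanded angular equation, and conjugation of the radial equation
### to the ingoing chart -/

/-- The printed angular operator expanded by the product rule:
`d/dθ(sin θ S') = cos θ S' + sin θ S''` at a point where `S'` is differentiable. [folklore] -/
theorem deriv_sin_mul_deriv {S : ℝ → ℂ} {θ : ℝ} (hS : DifferentiableAt ℝ (deriv S) θ) :
    deriv (fun t ↦ (sin t : ℂ) * deriv S t) θ = cos θ * deriv S θ + sin θ * deriv (deriv S) θ := by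
  rw [(((hasDerivAt_sin θ).ofReal_comp).fun_mul hS.hasDerivAt).deriv]

/-- `C²` functions `ℝ → ℂ`: the derivative is differentiable. [folklore] -/
theorem differentiableAt_deriv_of_contDiffAt {g : ℝ → ℂ} {x : ℝ} (hg : ContDiffAt ℝ 2 g x) :
    DifferentiableAt ℝ (deriv g) x :=
  (hg.derivWithin (m := 1) (by norm_num)).differentiableAt one_ne_zero

/-- **Conjugation of the radial ODE to the ingoing chart.** Let `Δ = s² − 2Ms + a²`,
`V = −(s² + a²)²ω² + 4Mamsω − a²m² + Δ(λ + a²ω² + μ²s²)`, and near `r` let `Δ ≠ 0`,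
`dt̄/ds = (s² + a²)/Δ`, `dφ̄/ds = a/Δ` (SR §1.2.1), `R` differentiable with `R'` differentiable at `r`,
`R = e^{−i(ω t̄ − m φ̄)} f` (the horizon-regular form (2.3)) with `f` of class `C²` at `r`, and let `R`
solve the radial ODE (2.2) at `r`: `Δ d/ds(Δ dR/ds) − V R = 0`. Then `u(s) = e^{−iωs} f(s)` — the
radial profile of the mode in the chart `(t_KS, r, θ, φ_KS)`, since
`e^{−iωt}e^{imφ} R = e^{−iωt_KS} e^{imφ_KS} e^{−iωs} f` (`t = t_KS + s − t̄`, `φ = φ_KS − φ̄`) —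
solves the **ingoing radial ODE** at `r`:
`Δ u'' + Δ' u' + (2iam − 4iωMr) u' + (ω²(r² + 2Mr) − 2iωM − λ − μ²r²) u = 0`.
(Proof: `u = e^{iχ}R` with `Δχ' = 2Mωs − am =: K`, so `Δu' = e^{iχ}(iKR + ΔR')`, and
`Δ e^{−iχ} × (ingoing operator applied to u) = Δ(ΔR')' − VR` because
`K² + ω²(r² + 2Mr)Δ − (λ + μ²r²)Δ = −V + 2iωMΔ·0 …`, an identity of polynomials.)
SR, CMP 329 (2014), §1.2.1 (`t̄`, `φ̄`), §2 (2.2)–(2.3). [cite: ShlapentokhRothman2014KleinGordon, §2 (2.2)–(2.3)] -/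
theorem ingoingRadial_of_radialODE {M a μ : ℝ} {w lam : ℂ} {m : ℤ} {R f : ℝ → ℂ}
    {tbar phibar : ℝ → ℝ} {r : ℝ}
    (hΔ : ∀ᶠ s in 𝓝 r, s ^ 2 - 2 * M * s + a ^ 2 ≠ 0)
    (ht : ∀ᶠ s in 𝓝 r, HasDerivAt tbar ((s ^ 2 + a ^ 2) / (s ^ 2 - 2 * M * s + a ^ 2)) s)
    (hp : ∀ᶠ s in 𝓝 r, HasDerivAt phibar (a / (s ^ 2 - 2 * M * s + a ^ 2)) s)
    (hR : ∀ᶠ s in 𝓝 r, DifferentiableAt ℝ R s) (hR2 : DifferentiableAt ℝ (deriv R) r)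
    (hf : ∀ᶠ s in 𝓝 r, R s =
      Complex.exp (-Complex.I * (w * tbar s - m * phibar s)) * f s)
    (hfC : ContDiffAt ℝ 2 f r)
    (hODE : ((r ^ 2 - 2 * M * r + a ^ 2 : ℝ) : ℂ) *
        deriv (fun s : ℝ ↦ ((s ^ 2 - 2 * M * s + a ^ 2 : ℝ) : ℂ) * deriv R s) r
      - (-(r ^ 2 + a ^ 2) ^ 2 * w ^ 2 + 4 * M * a * m * r * w - a ^ 2 * m ^ 2
          + (r ^ 2 - 2 * M * r + a ^ 2) * (lam + a ^ 2 * w ^ 2 + μ ^ 2 * r ^ 2) : ℂ) * R r = 0) :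
    (r ^ 2 - 2 * M * r + a ^ 2 : ℂ) *
        deriv (deriv (fun s : ℝ ↦ Complex.exp (-Complex.I * w * (s : ℂ)) * f s)) r
      + (2 * r - 2 * M : ℂ) * deriv (fun s : ℝ ↦ Complex.exp (-Complex.I * w * (s : ℂ)) * f s) r
      + (2 * Complex.I * a * m - 4 * Complex.I * w * M * r) *
          deriv (fun s : ℝ ↦ Complex.exp (-Complex.I * w * (s : ℂ)) * f s) r
      + (w ^ 2 * (r ^ 2 + 2 * M * r) - 2 * Complex.I * w * M - lam - μ ^ 2 * r ^ 2) *
          (Complex.exp (-Complex.I * w * (r : ℂ)) * f r) = 0 := by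
  -- notation: `Δ`, `K = 2Mωs − am`, the phase `χ` and its derivative `κ`
  set K : ℝ → ℂ := fun s ↦ 2 * M * w * s - a * m with hK_def
  set χ : ℝ → ℂ := fun s ↦ w * ((tbar s : ℂ) - s) - m * (phibar s : ℂ) with hχ_def
  set κ : ℝ → ℂ := fun s ↦ w * ((((s ^ 2 + a ^ 2) / (s ^ 2 - 2 * M * s + a ^ 2) : ℝ) : ℂ) - 1) - m * (((a / (s ^ 2 - 2 * M * s + a ^ 2) : ℝ)) : ℂ)
    with hκ_def
  set E : ℝ → ℂ := fun s ↦ Complex.exp (Complex.I * χ s) with hE_def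
  set u : ℝ → ℂ := fun s : ℝ ↦ Complex.exp (-Complex.I * w * (s : ℂ)) * f s with hu_def
  have hΔr : (r ^ 2 - 2 * M * r + a ^ 2) ≠ 0 := hΔ.self_of_nhds
  have hΔC : ((r ^ 2 - 2 * M * r + a ^ 2 : ℝ) : ℂ) ≠ 0 := by exact_mod_cast hΔr
  -- `Δ κ = K`
  have hκK : ∀ s, (s ^ 2 - 2 * M * s + a ^ 2) ≠ 0 →
      ((s ^ 2 - 2 * M * s + a ^ 2 : ℝ) : ℂ) * κ s = K s := by
    intro s hs
    have hsC : ((s ^ 2 - 2 * M * s + a ^ 2 : ℝ) : ℂ) ≠ 0 := by exact_mod_cast hs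
    calc ((s ^ 2 - 2 * M * s + a ^ 2 : ℝ) : ℂ) * κ s
        = w * (((s ^ 2 - 2 * M * s + a ^ 2 : ℝ) : ℂ) *
              (((s ^ 2 + a ^ 2) / (s ^ 2 - 2 * M * s + a ^ 2) : ℝ) : ℂ) -
              ((s ^ 2 - 2 * M * s + a ^ 2 : ℝ) : ℂ)) -
            m * (((s ^ 2 - 2 * M * s + a ^ 2 : ℝ) : ℂ) *
              (((a / (s ^ 2 - 2 * M * s + a ^ 2) : ℝ)) : ℂ)) := by simp only [hκ_def]; ring
      _ = w * (((s ^ 2 + a ^ 2 : ℝ) : ℂ) - ((s ^ 2 - 2 * M * s + a ^ 2 : ℝ) : ℂ)) - m * (a : ℂ) := by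
          rw [Complex.ofReal_div, Complex.ofReal_div, mul_div_cancel₀ _ hsC, mul_div_cancel₀ _ hsC]
      _ = K s := by simp only [hK_def]; push_cast; ring
  -- derivative of the phase
  have hχd : ∀ᶠ s in 𝓝 r, HasDerivAt χ (κ s) s := by
    filter_upwards [ht, hp] with s hts hps
    have h1 : HasDerivAt (fun s ↦ (tbar s : ℂ) - s)
        ((((s ^ 2 + a ^ 2) / (s ^ 2 - 2 * M * s + a ^ 2) : ℝ) : ℂ) - 1) s := by
      exact hts.ofReal_comp.sub (Complex.ofRealCLM.hasDerivAt)
    have h2 : HasDerivAt (fun s ↦ (phibar s : ℂ)) (((a / (s ^ 2 - 2 * M * s + a ^ 2) : ℝ)) : ℂ) s := hps.ofReal_comp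
    exact (h1.const_mul w).sub (h2.const_mul (m : ℂ))
  -- derivative of `E = e^{iχ}`
  have hEd : ∀ᶠ s in 𝓝 r, HasDerivAt E (E s * (Complex.I * κ s)) s := by
    filter_upwards [hχd] with s hs
    exact (Complex.hasDerivAt_exp _).comp s (hs.const_mul Complex.I)
  -- `u = E R` near `r`
  have huv : u =ᶠ[𝓝 r] fun s ↦ E s * R s := by
    filter_upwards [hf] with s hs
    simp only [hu_def, hE_def]
    rw [hs, ← mul_assoc, ← Complex.exp_add]
    congr 1
    simp only [hχ_def]
    ring
  -- derivative of `u` near `r`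
  have hud : ∀ᶠ s in 𝓝 r, HasDerivAt u (E s * (Complex.I * κ s * R s + deriv R s)) s := by
    filter_upwards [hEd, hR, eventually_eventuallyEq_nhds.2 huv] with s hE hRs huvs
    rw [huvs.hasDerivAt_iff]
    exact (hE.fun_mul hRs.hasDerivAt).congr_deriv (by ring)
  have hud_eq : deriv u =ᶠ[𝓝 r] fun s ↦ E s * (Complex.I * κ s * R s + deriv R s) :=
    hud.mono fun s hs ↦ hs.deriv
  -- `Δ u' = E (iK R + Δ R')` near `r`
  have hW : (fun s ↦ ((s ^ 2 - 2 * M * s + a ^ 2 : ℝ) : ℂ) * deriv u s) =ᶠ[𝓝 r]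
      fun s ↦ E s * (Complex.I * K s * R s + ((s ^ 2 - 2 * M * s + a ^ 2 : ℝ) : ℂ) * deriv R s) := by
    filter_upwards [hud_eq, hΔ] with s hs hΔs
    rw [hs, ← hκK s hΔs]
    ring
  -- derivative of `Δ u'` at `r`
  have hQ : HasDerivAt (fun s ↦ ((s ^ 2 - 2 * M * s + a ^ 2 : ℝ) : ℂ) * deriv R s)
      (deriv (fun s ↦ ((s ^ 2 - 2 * M * s + a ^ 2 : ℝ) : ℂ) * deriv R s) r) r := by
    have hΔd : DifferentiableAt ℝ (fun s : ℝ ↦ ((s ^ 2 - 2 * M * s + a ^ 2 : ℝ) : ℂ)) r := by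
      fun_prop
    exact (hΔd.mul hR2).hasDerivAt
  have hKd : HasDerivAt K (2 * M * w) r := by
    simp only [hK_def]
    simpa using ((Complex.ofRealCLM.hasDerivAt (x := r)).const_mul (2 * M * w)).sub_const ((a : ℂ) * m)
  have hWd : HasDerivAt (fun s ↦ E s * (Complex.I * K s * R s + ((s ^ 2 - 2 * M * s + a ^ 2 : ℝ) : ℂ) * deriv R s))
      (E r * (Complex.I * κ r) * (Complex.I * K r * R r + ((r ^ 2 - 2 * M * r + a ^ 2 : ℝ) : ℂ) * deriv R r) +
        E r * (Complex.I * (2 * M * w) * R r + Complex.I * K r * deriv R r +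
          deriv (fun s ↦ ((s ^ 2 - 2 * M * s + a ^ 2 : ℝ) : ℂ) * deriv R s) r)) r := by
    have hin := ((hKd.const_mul Complex.I).fun_mul hR.self_of_nhds.hasDerivAt).fun_add hQ
    exact (hEd.self_of_nhds.fun_mul hin).congr_deriv (by ring)
  have hΔu' : deriv (fun s ↦ ((s ^ 2 - 2 * M * s + a ^ 2 : ℝ) : ℂ) * deriv u s) r =
      E r * (Complex.I * κ r) * (Complex.I * K r * R r + ((r ^ 2 - 2 * M * r + a ^ 2 : ℝ) : ℂ) * deriv R r) +
        E r * (Complex.I * (2 * M * w) * R r + Complex.I * K r * deriv R r +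
          deriv (fun s ↦ ((s ^ 2 - 2 * M * s + a ^ 2 : ℝ) : ℂ) * deriv R s) r) := by
    rw [hW.deriv_eq, hWd.deriv]
  -- the same derivative by the product rule: `Δ' u' + Δ u''`
  have huC : ContDiffAt ℝ 2 u r := by
    have : ContDiff ℝ 2 (fun s : ℝ ↦ Complex.exp (-Complex.I * w * (s : ℂ))) :=
      Complex.contDiff_exp.comp (contDiff_const.mul Complex.ofRealCLM.contDiff)
    exact this.contDiffAt.mul hfC
  have hu2 : DifferentiableAt ℝ (deriv u) r := differentiableAt_deriv_of_contDiffAt huC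
  have hΔu'' : deriv (fun s ↦ ((s ^ 2 - 2 * M * s + a ^ 2 : ℝ) : ℂ) * deriv u s) r =
      (2 * r - 2 * M : ℂ) * deriv u r + ((r ^ 2 - 2 * M * r + a ^ 2 : ℝ) : ℂ) * deriv (deriv u) r := by
    have hΔd : HasDerivAt (fun s : ℝ ↦ ((s ^ 2 - 2 * M * s + a ^ 2 : ℝ) : ℂ))
        (2 * r - 2 * M : ℂ) r := by
      have h1 : HasDerivAt (fun s : ℝ ↦ s ^ 2 - 2 * M * s + a ^ 2) (2 * r - 2 * M) r := by
        simpa using (((hasDerivAt_id r).pow 2).sub ((hasDerivAt_id r).const_mul (2 * M))).add_const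
          (a ^ 2)
      simpa using h1.ofReal_comp
    rw [(hΔd.fun_mul hu2.hasDerivAt).deriv]
  -- values at `r`
  have hur : u r = E r * R r := huv.self_of_nhds
  have hu'r : deriv u r = E r * (Complex.I * κ r * R r + deriv R r) := hud.self_of_nhds.deriv
  have hκr : κ r = K r / ((r ^ 2 - 2 * M * r + a ^ 2 : ℝ) : ℂ) := by
    rw [eq_div_iff hΔC, mul_comm]
    exact hκK r hΔr
  -- assemble
  have key : ((r ^ 2 - 2 * M * r + a ^ 2 : ℝ) : ℂ) * deriv (deriv u) r + (2 * r - 2 * M : ℂ) * deriv u r =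
      deriv (fun s ↦ ((s ^ 2 - 2 * M * s + a ^ 2 : ℝ) : ℂ) * deriv u s) r := by rw [hΔu'']; ring
  have hcast : (r ^ 2 - 2 * M * r + a ^ 2 : ℂ) = ((r ^ 2 - 2 * M * r + a ^ 2 : ℝ) : ℂ) := by
    push_cast; ring
  rw [hcast, show Complex.exp (-Complex.I * w * (r : ℂ)) * f r = u r from rfl,
    show ((r ^ 2 - 2 * M * r + a ^ 2 : ℝ) : ℂ) * deriv (deriv u) r + (2 * ↑r - 2 * ↑M) * deriv u r +
      (2 * Complex.I * ↑a * ↑m - 4 * Complex.I * w * ↑M * ↑r) * deriv u r +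
      (w ^ 2 * (↑r ^ 2 + 2 * ↑M * ↑r) - 2 * Complex.I * w * ↑M - lam - ↑μ ^ 2 * ↑r ^ 2) * u r =
      deriv (fun s ↦ ((s ^ 2 - 2 * M * s + a ^ 2 : ℝ) : ℂ) * deriv u s) r +
      (2 * Complex.I * ↑a * ↑m - 4 * Complex.I * w * ↑M * ↑r) * deriv u r +
      (w ^ 2 * (↑r ^ 2 + 2 * ↑M * ↑r) - 2 * Complex.I * w * ↑M - lam - ↑μ ^ 2 * ↑r ^ 2) * u r by
      rw [← key],
    hΔu', hu'r, hur]
  refine mul_left_cancel₀ hΔC ?_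
  rw [mul_zero]
  have hk := hκK r hΔr
  clear_value u E κ χ K
  simp only [hK_def] at hk ⊢
  push_cast at hODE hk hΔC ⊢
  linear_combination (E r * ((2 * M * w * r - a * m) * R r +
    Complex.I * (r ^ 2 - 2 * M * r + a ^ 2) * deriv R r)) * hk + (E r) * hODE -
    (E r * κ r * (2 * M * w * r - a * m) * R r * (r ^ 2 - 2 * M * r + a ^ 2)) * Complex.I_sq

/-! ### Bounds for the ingoing radial factor `u = e^{−iωr} f` -/

/-- `|e^{−iωs}| = e^{(Im ω) s}` for real `s`. [folklore] -/
theorem norm_exp_neg_I_mul (w : ℂ) (s : ℝ) :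
    ‖Complex.exp (-Complex.I * w * (s : ℂ))‖ = Real.exp (w.im * s) := by
  rw [Complex.norm_exp]
  congr 1
  simp [Complex.mul_re, Complex.mul_im]

/-- The ingoing radial factor in terms of the Boyer–Lindquist one: if `R = e^{−i(ωt̄ − mφ̄)} f` then
`e^{−iωs} f = e^{i(ω(t̄ − s) − mφ̄)} R`. [cite: ShlapentokhRothman2014KleinGordon, §2 (2.3)] -/
theorem ingoing_eq_conj {w : ℂ} {m : ℤ} {Rs fs : ℂ} {t p : ℝ} (s : ℝ)
    (h : Rs = Complex.exp (-Complex.I * (w * t - m * p)) * fs) :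
    Complex.exp (-Complex.I * w * (s : ℂ)) * fs =
      Complex.exp (Complex.I * (w * ((t : ℂ) - s) - m * (p : ℂ))) * Rs := by
  rw [h, ← mul_assoc, ← Complex.exp_add]
  congr 1
  ring

/-- `|e^{i(ω(t̄ − s) − mφ̄)}| = e^{−(Im ω)(t̄ − s)}` for real `t̄, s, φ̄`, `m ∈ ℤ`. [folklore] -/
theorem norm_conj_phase (w : ℂ) (m : ℤ) (t s p : ℝ) :
    ‖Complex.exp (Complex.I * (w * ((t : ℂ) - s) - m * (p : ℂ)))‖ = Real.exp (-(w.im * (t - s))) := by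
  rw [Complex.norm_exp]
  congr 1
  simp [Complex.mul_re, Complex.mul_im, Complex.sub_re, Complex.sub_im]

/-- Derivative of the ingoing radial factor through the conjugation: near `s`, if
`R = e^{−i(ωt̄ − mφ̄)} f` with `dt̄/ds = (s² + a²)/Δ`, `dφ̄/ds = a/Δ` and `R` differentiable at `s`,
then `u = e^{−iωs} f` has derivative `e^{iχ}(iκ R + R')` at `s`, `χ = ω(t̄ − s) − mφ̄`,
`κ = ω((s² + a²)/Δ − 1) − m a/Δ`. [cite: ShlapentokhRothman2014KleinGordon, §1.2.1 and §2 (2.3)] -/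
theorem hasDerivAt_ingoing_conj {M a : ℝ} {w : ℂ} {m : ℤ} {R f : ℝ → ℂ} {tbar phibar : ℝ → ℝ}
    {s : ℝ}
    (ht : HasDerivAt tbar ((s ^ 2 + a ^ 2) / (s ^ 2 - 2 * M * s + a ^ 2)) s)
    (hp : HasDerivAt phibar (a / (s ^ 2 - 2 * M * s + a ^ 2)) s)
    (hR : DifferentiableAt ℝ R s)
    (hf : ∀ᶠ s' in 𝓝 s, R s' = Complex.exp (-Complex.I * (w * tbar s' - m * phibar s')) * f s') :
    HasDerivAt (fun s : ℝ ↦ Complex.exp (-Complex.I * w * (s : ℂ)) * f s)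
      (Complex.exp (Complex.I * (w * ((tbar s : ℂ) - s) - m * (phibar s : ℂ))) *
        (Complex.I * (w * ((((s ^ 2 + a ^ 2) / (s ^ 2 - 2 * M * s + a ^ 2) : ℝ) : ℂ) - 1) -
          m * (((a / (s ^ 2 - 2 * M * s + a ^ 2) : ℝ)) : ℂ)) * R s + deriv R s)) s := by
  set χ : ℝ → ℂ := fun s ↦ w * ((tbar s : ℂ) - s) - m * (phibar s : ℂ) with hχ_def
  have hχd : HasDerivAt χ (w * ((((s ^ 2 + a ^ 2) / (s ^ 2 - 2 * M * s + a ^ 2) : ℝ) : ℂ) - 1) -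
      m * (((a / (s ^ 2 - 2 * M * s + a ^ 2) : ℝ)) : ℂ)) s := by
    have h1 : HasDerivAt (fun s ↦ (tbar s : ℂ) - s)
        ((((s ^ 2 + a ^ 2) / (s ^ 2 - 2 * M * s + a ^ 2) : ℝ) : ℂ) - 1) s :=
      ht.ofReal_comp.sub (Complex.ofRealCLM.hasDerivAt)
    exact (h1.const_mul w).sub (hp.ofReal_comp.const_mul (m : ℂ))
  have hEd : HasDerivAt (fun s ↦ Complex.exp (Complex.I * χ s))
      (Complex.exp (Complex.I * χ s) * (Complex.I * (w * ((((s ^ 2 + a ^ 2) /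
        (s ^ 2 - 2 * M * s + a ^ 2) : ℝ) : ℂ) - 1) - m * (((a / (s ^ 2 - 2 * M * s + a ^ 2) : ℝ)) : ℂ)))) s :=
    (Complex.hasDerivAt_exp _).comp s (hχd.const_mul Complex.I)
  have huv : (fun s : ℝ ↦ Complex.exp (-Complex.I * w * (s : ℂ)) * f s) =ᶠ[𝓝 s]
      fun s ↦ Complex.exp (Complex.I * χ s) * R s := by
    filter_upwards [hf] with s' hs'
    exact ingoing_eq_conj s' hs'
  rw [huv.hasDerivAt_iff]
  exact (hEd.fun_mul hR.hasDerivAt).congr_deriv (by simp only [hχ_def]; ring)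

/-- **Bound for the conjugating frequency** `κ = (2Mωs − am)/Δ` on `[r₊ + 1, ∞)`:
`|κ| ≤ 2M|ω|(1 + r₊) + |a||m|` (there `Δ = (s − r₊)(s − r₋) ≥ (s − r₊)² ≥ 1` and
`s ≤ (1 + r₊)(s − r₊)`). [folklore] -/
theorem norm_kappa_le {M a : ℝ} (hMa : Kerr.IsSubextremal M a) (w : ℂ) (m : ℤ) {s : ℝ}
    (hs : Kerr.rPlus M a + 1 ≤ s) :
    ‖w * ((((s ^ 2 + a ^ 2) / (s ^ 2 - 2 * M * s + a ^ 2) : ℝ) : ℂ) - 1) -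
        m * (((a / (s ^ 2 - 2 * M * s + a ^ 2) : ℝ)) : ℂ)‖ ≤
      2 * M * ‖w‖ * (1 + Kerr.rPlus M a) + |a| * |(m : ℝ)| := by
  have hrp : 0 < Kerr.rPlus M a := hMa.rPlus_pos
  have hM : 0 < M := hMa.pos
  have hs1 : 1 ≤ s - Kerr.rPlus M a := by linarith
  have hs' : Kerr.rPlus M a < s := by linarith
  have hΔeq : s ^ 2 - 2 * M * s + a ^ 2 = (s - Kerr.rPlus M a) * (s - Kerr.rMinus M a) :=
    (Kerr.sub_rPlus_mul_sub_rMinus hMa.sq_lt_sq.le s).symm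
  have hΔpos : 0 < s ^ 2 - 2 * M * s + a ^ 2 := by rw [hΔeq]; exact Kerr.sub_rPlus_mul_sub_rMinus_pos hs'
  have hΔge : (s - Kerr.rPlus M a) ^ 2 ≤ s ^ 2 - 2 * M * s + a ^ 2 := by
    rw [hΔeq]; exact Kerr.sq_sub_rPlus_le hs'
  have hΔ1 : 1 ≤ s ^ 2 - 2 * M * s + a ^ 2 := by nlinarith
  have hspos : 0 < s := by linarith
  -- `s/Δ ≤ 1 + r₊` and `1/Δ ≤ 1`
  have h1 : s / (s ^ 2 - 2 * M * s + a ^ 2) ≤ 1 + Kerr.rPlus M a := by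
    rw [div_le_iff₀ hΔpos]
    have : s ≤ (1 + Kerr.rPlus M a) * (s - Kerr.rPlus M a) := by nlinarith
    nlinarith
  have h2 : |a| / (s ^ 2 - 2 * M * s + a ^ 2) ≤ |a| :=
    div_le_self (abs_nonneg a) hΔ1
  -- the algebraic identity `κ = (2Mωs − am)/Δ`
  have hreal : (s ^ 2 + a ^ 2) / (s ^ 2 - 2 * M * s + a ^ 2) - 1 =
      2 * M * (s / (s ^ 2 - 2 * M * s + a ^ 2)) := by
    rw [div_sub_one hΔpos.ne', mul_div_assoc']
    congr 1
    ring
  have hkey : w * ((((s ^ 2 + a ^ 2) / (s ^ 2 - 2 * M * s + a ^ 2) : ℝ) : ℂ) - 1) -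
      m * (((a / (s ^ 2 - 2 * M * s + a ^ 2) : ℝ)) : ℂ) =
      ((2 * M : ℝ) : ℂ) * w * ((s / (s ^ 2 - 2 * M * s + a ^ 2) : ℝ) : ℂ) -
        m * (((a / (s ^ 2 - 2 * M * s + a ^ 2) : ℝ)) : ℂ) := by
    have hC := congrArg (fun x : ℝ ↦ (x : ℂ)) hreal
    simp only [Complex.ofReal_sub, Complex.ofReal_one, Complex.ofReal_mul] at hC
    rw [hC]
    push_cast
    ring
  rw [hkey]
  refine (norm_sub_le _ _).trans (add_le_add ?_ ?_)
  · rw [norm_mul, norm_mul, Complex.norm_real, Complex.norm_real, Real.norm_eq_abs, Real.norm_eq_abs,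
      abs_of_nonneg (div_nonneg hspos.le hΔpos.le), abs_of_pos (by positivity : (0 : ℝ) < 2 * M)]
    have h0 : 0 ≤ 2 * M * ‖w‖ := by positivity
    exact mul_le_mul_of_nonneg_left h1 h0
  · rw [norm_mul, Complex.norm_intCast, Complex.norm_real, Real.norm_eq_abs, abs_div,
      abs_of_pos hΔpos, mul_comm]
    exact mul_le_mul_of_nonneg_right h2 (abs_nonneg _)

/-- Derivative of the ingoing radial factor by the product rule: `u' = e^{−iωs}(f' − iω f)`.
[folklore] -/
theorem hasDerivAt_ingoing {w : ℂ} {f : ℝ → ℂ} {s : ℝ} (hf : DifferentiableAt ℝ f s) :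
    HasDerivAt (fun s : ℝ ↦ Complex.exp (-Complex.I * w * (s : ℂ)) * f s)
      (Complex.exp (-Complex.I * w * (s : ℂ)) * (deriv f s - Complex.I * w * f s)) s := by
  have h1 : HasDerivAt (fun s : ℝ ↦ Complex.exp (-Complex.I * w * (s : ℂ)))
      (Complex.exp (-Complex.I * w * (s : ℂ)) * (-Complex.I * w)) s := by
    have h := (Complex.hasDerivAt_exp _).comp s
      ((Complex.ofRealCLM.hasDerivAt (x := s)).const_mul (-Complex.I * w))
    exact h.congr_deriv (by simp)
  exact (h1.fun_mul hf.hasDerivAt).congr_deriv (by ring)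

/-- **Exponential bounds for the ingoing radial factor.** Under the radial clauses of
`ModeSolution` (horizon form (2.3) with `f` smooth up to `r₊`, exponential decay of
`R`, `R'` on `[r₊ + 1, ∞)`) and `Im ω > 0`, the ingoing radial factor `u = e^{−iωr} f` and its
derivative are bounded by `C₁ e^{−κr}` on all of `(r₊, ∞)`: near the horizon `u = e^{−iωr} f` is
bounded with its derivative (`f` smooth on `[r₊, r₊ + 1]`); away from it `u = e^{i(ω(t̄ − r) − mφ̄)} R`
with `|e^{i(ω(t̄−r)−mφ̄)}| = e^{−Im ω (t̄ − r)}` and `t̄ − r` nondecreasing (`d(t̄ − r)/dr = 2Mr/Δ ≥ 0`),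
and `u' = e^{iχ}(iκR + R')` with `|κ| ≤ 2M|ω|(1 + r₊) + |am|`. SR, CMP 329 (2014), §2 ((2.3), (2.5)) and
§1.2.1. [cite: ShlapentokhRothman2014KleinGordon, §2 (2.3)–(2.5)] -/
theorem ingoing_bounds {M a : ℝ} (hMa : Kerr.IsSubextremal M a) {w : ℂ} (hw : 0 < w.im) {m : ℤ}
    {R f : ℝ → ℂ} {tbar phibar : ℝ → ℝ} {C κ : ℝ} (hκ : 0 < κ)
    (htp : ∀ r ∈ Ioi (Kerr.rPlus M a),
      HasDerivAt tbar ((r ^ 2 + a ^ 2) / (r ^ 2 - 2 * M * r + a ^ 2)) r ∧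
      HasDerivAt phibar (a / (r ^ 2 - 2 * M * r + a ^ 2)) r)
    (hf : ∀ r, Kerr.rPlus M a ≤ r → ContDiffAt ℝ ∞ f r)
    (hRf : ∀ r ∈ Ioi (Kerr.rPlus M a),
      R r = Complex.exp (-Complex.I * (w * tbar r - m * phibar r)) * f r)
    (hR2 : ContDiffOn ℝ 2 R (Ioi (Kerr.rPlus M a)))
    (hdec : ∀ r, Kerr.rPlus M a + 1 ≤ r →
      ‖R r‖ ≤ C * Real.exp (-(κ * r)) ∧ ‖deriv R r‖ ≤ C * Real.exp (-(κ * r))) :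
    ∃ C₁ : ℝ, ∀ r, Kerr.rPlus M a < r →
      ‖Complex.exp (-Complex.I * w * (r : ℂ)) * f r‖ ≤ C₁ * Real.exp (-(κ * r)) ∧
      ‖deriv (fun s : ℝ ↦ Complex.exp (-Complex.I * w * (s : ℂ)) * f s) r‖ ≤
        C₁ * Real.exp (-(κ * r)) := by
  set rp := Kerr.rPlus M a with hrp_def
  have hrp : 0 < rp := hMa.rPlus_pos
  have hM : 0 < M := hMa.pos
  -- (near) a bound for `f`, `f'` on `[r₊, r₊ + 1]`
  have hK : IsCompact (Icc rp (rp + 1)) := isCompact_Icc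
  have hfc : ContinuousOn f (Icc rp (rp + 1)) := fun s hs ↦
    (hf s hs.1).continuousAt.continuousWithinAt
  have hdfc : ContinuousOn (deriv f) (Icc rp (rp + 1)) := fun s hs ↦
    ((hf s hs.1).derivWithin (m := 1) (WithTop.coe_le_coe.2 le_top)).continuousAt.continuousWithinAt
  obtain ⟨Bf, hBf⟩ := hK.exists_bound_of_continuousOn hfc
  obtain ⟨Bdf, hBdf⟩ := hK.exists_bound_of_continuousOn hdfc
  set B : ℝ := max (max Bf Bdf) 0 with hB_def
  have hB0 : 0 ≤ B := le_max_right _ _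
  have hBf' : ∀ s ∈ Icc rp (rp + 1), ‖f s‖ ≤ B := fun s hs ↦
    (hBf s hs).trans ((le_max_left _ _).trans (le_max_left _ _))
  have hBdf' : ∀ s ∈ Icc rp (rp + 1), ‖deriv f s‖ ≤ B := fun s hs ↦
    (hBdf s hs).trans ((le_max_right _ _).trans (le_max_left _ _))
  -- (far) `t̄ − r` is nondecreasing on `[r₊ + 1, ∞)`
  have hmono : MonotoneOn (fun s ↦ tbar s - s) (Ici (rp + 1)) := by
    have hd : ∀ s, rp < s → HasDerivAt (fun s ↦ tbar s - s)
        ((s ^ 2 + a ^ 2) / (s ^ 2 - 2 * M * s + a ^ 2) - 1) s := fun s hs ↦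
      (htp s hs).1.sub (hasDerivAt_id s)
    refine monotoneOn_of_deriv_nonneg (convex_Ici _) ?_ ?_ ?_
    · exact fun s hs ↦ (hd s (by linarith [mem_Ici.1 hs])).continuousAt.continuousWithinAt
    · rw [interior_Ici]
      exact fun s hs ↦ (hd s (by linarith [mem_Ioi.1 hs])).differentiableAt.differentiableWithinAt
    · rw [interior_Ici]
      intro s hs
      have hs' : rp < s := by linarith [mem_Ioi.1 hs]
      have hspos : 0 < s := hrp.trans hs'
      have hΔpos : 0 < s ^ 2 - 2 * M * s + a ^ 2 := by
        rw [← Kerr.sub_rPlus_mul_sub_rMinus hMa.sq_lt_sq.le]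
        exact Kerr.sub_rPlus_mul_sub_rMinus_pos hs'
      rw [(hd s hs').deriv, div_sub_one hΔpos.ne']
      exact div_nonneg (by nlinarith) hΔpos.le
  -- constants
  set c₀ : ℝ := tbar (rp + 1) - (rp + 1) with hc₀_def
  set Eb : ℝ := Real.exp (-(w.im * c₀)) with hEb_def
  set Kb : ℝ := 2 * M * ‖w‖ * (1 + rp) + |a| * |(m : ℝ)| with hKb_def
  have hKb0 : 0 ≤ Kb := by positivity
  set Cp : ℝ := max C 0 with hCp_def
  have hCp0 : 0 ≤ Cp := le_max_right _ _
  set Cnear : ℝ := Real.exp (w.im * (rp + 1)) * (‖w‖ + 1) * B * Real.exp (κ * (rp + 1)) with hCnear_def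
  set Cfar : ℝ := Eb * (Kb + 1) * Cp with hCfar_def
  refine ⟨max Cnear Cfar, fun r hr ↦ ?_⟩
  have hexp_pos : 0 < Real.exp (-(κ * r)) := Real.exp_pos _
  by_cases hcase : r ≤ rp + 1
  · -- near the horizon
    have hrK : r ∈ Icc rp (rp + 1) := ⟨hr.le, hcase⟩
    have hE : ‖Complex.exp (-Complex.I * w * (r : ℂ))‖ ≤ Real.exp (w.im * (rp + 1)) := by
      rw [norm_exp_neg_I_mul]
      exact Real.exp_le_exp.2 (mul_le_mul_of_nonneg_left hcase hw.le)
    have hone : 1 ≤ Real.exp (κ * (rp + 1)) * Real.exp (-(κ * r)) := by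
      rw [← Real.exp_add]
      exact Real.one_le_exp (by nlinarith)
    have hfd : DifferentiableAt ℝ f r := (hf r hr.le).differentiableAt (by simp)
    -- the common bound `e^{Im ω (r₊+1)} (|ω| + 1) B`
    have hval : ‖Complex.exp (-Complex.I * w * (r : ℂ)) * f r‖ ≤
        Real.exp (w.im * (rp + 1)) * (‖w‖ + 1) * B := by
      rw [norm_mul]
      calc ‖Complex.exp (-Complex.I * w * (r : ℂ))‖ * ‖f r‖
          ≤ Real.exp (w.im * (rp + 1)) * B :=
            mul_le_mul hE (hBf' r hrK) (norm_nonneg _) (Real.exp_pos _).le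
        _ ≤ Real.exp (w.im * (rp + 1)) * (‖w‖ + 1) * B := by
            have : Real.exp (w.im * (rp + 1)) * B ≤ Real.exp (w.im * (rp + 1)) * B * (‖w‖ + 1) :=
              le_mul_of_one_le_right (by positivity) (by linarith [norm_nonneg w])
            linarith
    have hder : ‖deriv (fun s : ℝ ↦ Complex.exp (-Complex.I * w * (s : ℂ)) * f s) r‖ ≤
        Real.exp (w.im * (rp + 1)) * (‖w‖ + 1) * B := by
      rw [(hasDerivAt_ingoing (w := w) hfd).deriv, norm_mul]
      have h2 : ‖deriv f r - Complex.I * w * f r‖ ≤ (‖w‖ + 1) * B := by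
        refine (norm_sub_le _ _).trans ?_
        rw [norm_mul, norm_mul, Complex.norm_I, one_mul]
        have := hBf' r hrK
        have := hBdf' r hrK
        nlinarith [norm_nonneg w, norm_nonneg (f r)]
      calc ‖Complex.exp (-Complex.I * w * (r : ℂ))‖ * ‖deriv f r - Complex.I * w * f r‖
          ≤ Real.exp (w.im * (rp + 1)) * ((‖w‖ + 1) * B) :=
            mul_le_mul hE h2 (norm_nonneg _) (Real.exp_pos _).le
        _ = Real.exp (w.im * (rp + 1)) * (‖w‖ + 1) * B := by ring
    have hfin : Real.exp (w.im * (rp + 1)) * (‖w‖ + 1) * B ≤ max Cnear Cfar * Real.exp (-(κ * r)) := by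
      calc Real.exp (w.im * (rp + 1)) * (‖w‖ + 1) * B
          ≤ Real.exp (w.im * (rp + 1)) * (‖w‖ + 1) * B *
              (Real.exp (κ * (rp + 1)) * Real.exp (-(κ * r))) :=
            le_mul_of_one_le_right (by positivity) hone
        _ = Cnear * Real.exp (-(κ * r)) := by simp only [hCnear_def]; ring
        _ ≤ max Cnear Cfar * Real.exp (-(κ * r)) :=
            mul_le_mul_of_nonneg_right (le_max_left _ _) hexp_pos.le
    exact ⟨hval.trans hfin, hder.trans hfin⟩
  · -- away from the horizon
    push Not at hcase
    have hr1 : rp + 1 ≤ r := hcase.le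
    obtain ⟨hRr, hR'r⟩ := hdec r hr1
    have hRr' : ‖R r‖ ≤ Cp * Real.exp (-(κ * r)) :=
      hRr.trans (mul_le_mul_of_nonneg_right (le_max_left _ _) hexp_pos.le)
    have hR'r' : ‖deriv R r‖ ≤ Cp * Real.exp (-(κ * r)) :=
      hR'r.trans (mul_le_mul_of_nonneg_right (le_max_left _ _) hexp_pos.le)
    -- the conjugating phase and its modulus
    have hE : ‖Complex.exp (Complex.I * (w * ((tbar r : ℂ) - r) - m * (phibar r : ℂ)))‖ ≤ Eb := by
      rw [norm_conj_phase, hEb_def]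
      refine Real.exp_le_exp.2 (neg_le_neg (mul_le_mul_of_nonneg_left ?_ hw.le))
      exact hmono (mem_Ici.2 le_rfl) (mem_Ici.2 hr1) hr1
    have hEb0 : 0 ≤ Eb := (Real.exp_pos _).le
    -- `u = e^{iχ} R`
    have hu : Complex.exp (-Complex.I * w * (r : ℂ)) * f r =
        Complex.exp (Complex.I * (w * ((tbar r : ℂ) - r) - m * (phibar r : ℂ))) * R r :=
      ingoing_eq_conj r (hRf r hr)
    have hval : ‖Complex.exp (-Complex.I * w * (r : ℂ)) * f r‖ ≤ Eb * (Cp * Real.exp (-(κ * r))) := by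
      rw [hu, norm_mul]
      exact mul_le_mul hE hRr' (norm_nonneg _) hEb0
    -- `u' = e^{iχ}(iκ R + R')`
    have hI : Ioi rp ∈ 𝓝 r := Ioi_mem_nhds hr
    have hRd : DifferentiableAt ℝ R r := (hR2.contDiffAt hI).differentiableAt (by simp)
    have hfev : ∀ᶠ s in 𝓝 r, R s = Complex.exp (-Complex.I * (w * tbar s - m * phibar s)) * f s := by
      filter_upwards [hI] with s hs using hRf s hs
    have hder : ‖deriv (fun s : ℝ ↦ Complex.exp (-Complex.I * w * (s : ℂ)) * f s) r‖ ≤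
        Eb * ((Kb + 1) * (Cp * Real.exp (-(κ * r)))) := by
      rw [(hasDerivAt_ingoing_conj (htp r hr).1 (htp r hr).2 hRd hfev).deriv, norm_mul]
      refine mul_le_mul hE ?_ (norm_nonneg _) hEb0
      refine (norm_add_le _ _).trans ?_
      rw [norm_mul, norm_mul, Complex.norm_I, one_mul, add_mul, one_mul]
      refine add_le_add ?_ hR'r'
      exact mul_le_mul (norm_kappa_le hMa w m hr1) hRr' (norm_nonneg _) hKb0
    have hfin : Eb * ((Kb + 1) * (Cp * Real.exp (-(κ * r)))) ≤ max Cnear Cfar * Real.exp (-(κ * r)) := by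
      calc Eb * ((Kb + 1) * (Cp * Real.exp (-(κ * r)))) = Cfar * Real.exp (-(κ * r)) := by
            simp only [hCfar_def]; ring
        _ ≤ max Cnear Cfar * Real.exp (-(κ * r)) :=
            mul_le_mul_of_nonneg_right (le_max_right _ _) hexp_pos.le
    have hval' : Eb * (Cp * Real.exp (-(κ * r))) ≤ Eb * ((Kb + 1) * (Cp * Real.exp (-(κ * r)))) :=
      mul_le_mul_of_nonneg_left (le_mul_of_one_le_left (by positivity) (by linarith)) hEb0
    exact ⟨hval.trans (hval'.trans hfin), hder.trans hfin⟩

/-! ### Geometric bounds on the slice: `|∇r|` and `‖Dℓ⃗‖` -/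

/-- `|y_i| ≤ ‖y‖` on `E3`. [folklore] -/
theorem abs_apply_le_norm_E3 (y : E3) (i : Fin 3) : |y i| ≤ ‖y‖ := by
  have h := E3.norm_sq y
  refine abs_le_of_sq_le_sq ?_ (norm_nonneg _)
  have key : y i ^ 2 ≤ y 0 ^ 2 + y 1 ^ 2 + y 2 ^ 2 := by
    have h0 := sq_nonneg (y 0)
    have h1 := sq_nonneg (y 1)
    have h2 := sq_nonneg (y 2)
    fin_cases i
    · show y 0 ^ 2 ≤ _; linarith
    · show y 1 ^ 2 ≤ _; linarith
    · show y 2 ^ 2 ≤ _; linarith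
  linarith

/-- The coordinate projections of `E3` have operator norm `≤ 1`. [folklore] -/
theorem norm_proj_le_one (i : Fin 3) : ‖(EuclideanSpace.proj (𝕜 := ℝ) i : E3 →L[ℝ] ℝ)‖ ≤ 1 :=
  ContinuousLinearMap.opNorm_le_bound _ zero_le_one fun v ↦ by
    simpa using abs_apply_le_norm_E3 v i

/-- **`|∇r| ≤ 1 + |a|/r` on the leaf** (`|∇r|² = (r² + a²)/Σ ≤ (r² + a²)/r²`). Visser arXiv:0706.0622,
(35). [cite: arXiv07060622, (35)] -/
theorem norm_radiusGrad_le {a : ℝ} {y : E3} (hr : 0 < Kerr.radius a (E4.ofTimeSpace 0 y)) :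
    ‖Kerr.radiusGrad a y‖ ≤ 1 + |a| / Kerr.radius a (E4.ofTimeSpace 0 y) := by
  set r := Kerr.radius a (E4.ofTimeSpace 0 y) with hr_def
  have hnorm : ‖Kerr.radiusGrad a y‖ = ‖Kerr.radiusGradVec a y‖ := by
    rw [Kerr.radiusGrad]; exact innerSL_apply_norm ℝ _
  rw [hnorm]
  have hS := Kerr.blSigma_pos hr
  have hS2 := Kerr.sq_le_blSigma hr
  have hsq : ‖Kerr.radiusGradVec a y‖ ^ 2 = (r ^ 2 + a ^ 2) / Kerr.blSigma a y := by
    rw [← real_inner_self_eq_norm_sq, Kerr.inner_radiusGradVec_self hr]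
  have hle : ‖Kerr.radiusGradVec a y‖ ^ 2 ≤ (1 + |a| / r) ^ 2 := by
    rw [hsq, div_le_iff₀ hS]
    have h1 : (r ^ 2 + a ^ 2) ≤ (1 + |a| / r) ^ 2 * r ^ 2 := by
      rw [show (1 + |a| / r) ^ 2 * r ^ 2 = (r + |a|) ^ 2 by field_simp]
      rw [← sq_abs a]; nlinarith [abs_nonneg a, hr]
    exact h1.trans (mul_le_mul_of_nonneg_left hS2 (by positivity))
  exact (pow_le_pow_iff_left₀ (norm_nonneg _) (by positivity) two_ne_zero).1 hle

/-- The components of `ℓ⃗(0, y)`: `ℓ₁ = (r y₀ + a y₁)/(r² + a²)`. [cite: arXiv07060622, (34)] -/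
theorem nullSpatial_leaf_apply_zero (a : ℝ) (y : E3) :
    Kerr.nullSpatial a (E4.ofTimeSpace 0 y) 0 =
      (Kerr.radius a (E4.ofTimeSpace 0 y) * y 0 + a * y 1) /
        (Kerr.radius a (E4.ofTimeSpace 0 y) ^ 2 + a ^ 2) := by
  rw [Kerr.nullSpatial_apply]
  simp [Kerr.nullCovectorFun, E4.ofTimeSpace]

/-- `ℓ₂ = (r y₁ − a y₀)/(r² + a²)`. [cite: arXiv07060622, (34)] -/
theorem nullSpatial_leaf_apply_one (a : ℝ) (y : E3) :
    Kerr.nullSpatial a (E4.ofTimeSpace 0 y) 1 =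
      (Kerr.radius a (E4.ofTimeSpace 0 y) * y 1 - a * y 0) /
        (Kerr.radius a (E4.ofTimeSpace 0 y) ^ 2 + a ^ 2) := by
  rw [Kerr.nullSpatial_apply]
  simp [Kerr.nullCovectorFun, E4.ofTimeSpace]

/-- `ℓ₃ = y₂/r`. [cite: arXiv07060622, (34)] -/
theorem nullSpatial_leaf_apply_two (a : ℝ) (y : E3) :
    Kerr.nullSpatial a (E4.ofTimeSpace 0 y) 2 = y 2 / Kerr.radius a (E4.ofTimeSpace 0 y) := by
  rw [Kerr.nullSpatial_apply]
  exact Kerr.nullCovectorFun_ofTimeSpace_three a 0 y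

/-- Derivative of a quotient `p/q` of real functions on `E3`, with an operator-norm bound:
`D(p/q) = q⁻¹ Dp − (p/q²) Dq`, `‖D(p/q)‖ ≤ ‖Dp‖/|q| + |p| ‖Dq‖/q²`. [folklore] -/
theorem hasFDerivAt_div_E3 {p q : E3 → ℝ} {p' q' : E3 →L[ℝ] ℝ} {y : E3}
    (hp : HasFDerivAt p p' y) (hq : HasFDerivAt q q' y) (hq0 : q y ≠ 0) :
    HasFDerivAt (fun y ↦ p y / q y) ((q y)⁻¹ • p' - (p y / q y ^ 2) • q') y ∧
      ‖(q y)⁻¹ • p' - (p y / q y ^ 2) • q'‖ ≤ ‖p'‖ / |q y| + |p y| * ‖q'‖ / q y ^ 2 := by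
  constructor
  · have hinv : HasFDerivAt (fun y ↦ (q y)⁻¹) ((-(q y ^ 2)⁻¹) • q') y :=
      (hasDerivAt_inv hq0).comp_hasFDerivAt y hq
    have h := hp.fun_mul hinv
    have heq : (fun y ↦ p y / q y) = fun y ↦ p y * (q y)⁻¹ := by
      funext z; rw [div_eq_mul_inv]
    rw [heq]
    refine h.congr_fderiv ?_
    ext v
    simp only [sub_apply, FunLike.coe_smul, Pi.smul_apply, smul_eq_mul, add_apply]
    field_simp
    ring
  · refine (norm_sub_le _ _).trans (add_le_add ?_ ?_)
    · rw [norm_smul, norm_inv, Real.norm_eq_abs, div_eq_inv_mul]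
    · rw [norm_smul, Real.norm_eq_abs, abs_div, abs_pow, sq_abs, mul_div_right_comm]

/-- **The differential of `y ↦ ℓ⃗(0, y)` is bounded on `{r ≥ ρ}`** (`ρ > 0`): there is a constant
`B(a, ρ)` such that `‖D(ℓ⃗ ∘ (0, ·))(y)‖ ≤ B` whenever `r(0, y) ≥ ρ` — from the explicit components
`ℓ⃗ = ((r y₀ + a y₁)/(r² + a²), (r y₁ − a y₀)/(r² + a²), y₂/r)`, `|∇r| ≤ 1 + |a|/ρ`, `|y_i| ≤ ‖y‖ ≤ r + |a|`.
[cite: arXiv07060622, (34)–(35)] -/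
theorem exists_bound_fderiv_nullSpatial (a : ℝ) {ρ : ℝ} (hρ : 0 < ρ) :
    ∃ B : ℝ, ∀ y : E3, ρ ≤ Kerr.radius a (E4.ofTimeSpace 0 y) →
      ∃ L : E3 →L[ℝ] E3, HasFDerivAt (fun y : E3 ↦ Kerr.nullSpatial a (E4.ofTimeSpace 0 y)) L y ∧
        ‖L‖ ≤ B := by
  -- constants
  set q : ℝ := 1 + |a| / ρ with hq_def
  have hq1 : 1 ≤ q := by
    have : 0 ≤ |a| / ρ := by positivity
    linarith
  have hq0 : 0 ≤ q := by linarith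
  set B0 : ℝ := (2 * q ^ 2 * q + 1 + q * q + q) / ρ with hB0_def
  set B2 : ℝ := (q + 1) / ρ with hB2_def
  refine ⟨B0 + B0 + B2, fun y hy ↦ ?_⟩
  set r := Kerr.radius a (E4.ofTimeSpace 0 y) with hr_def
  have hr : 0 < r := hρ.trans_le hy
  have hA : |a| ≤ |a| / ρ * r := by
    rw [div_mul_eq_mul_div, le_div_iff₀ hρ]; exact mul_le_mul_of_nonneg_left hy (abs_nonneg a)
  have hyn : ‖y‖ ≤ q * r := by
    calc ‖y‖ ≤ r + |a| := norm_le_radius_add_abs hr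
      _ ≤ r + |a| / ρ * r := by linarith
      _ = q * r := by rw [hq_def]; ring
  have hyi : ∀ i, |y i| ≤ q * r := fun i ↦ (abs_apply_le_norm_E3 y i).trans hyn
  -- the gradient of the radius
  have hrad : HasFDerivAt (fun y : E3 ↦ Kerr.radius a (E4.ofTimeSpace 0 y)) (Kerr.radiusGrad a y) y :=
    Kerr.hasFDerivAt_radius_slice hr
  have hdr : ‖Kerr.radiusGrad a y‖ ≤ q := by
    refine (norm_radiusGrad_le hr).trans ?_
    rw [hq_def]
    gcongr
  set dr := Kerr.radiusGrad a y with hdr_def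
  set pr : Fin 3 → (E3 →L[ℝ] ℝ) := fun i ↦ EuclideanSpace.proj i with hpr_def
  have hprd : ∀ i, HasFDerivAt (fun y : E3 ↦ y i) (pr i) y := fun i ↦
    (EuclideanSpace.proj (𝕜 := ℝ) i).hasFDerivAt
  have hprn : ∀ i, ‖pr i‖ ≤ 1 := fun i ↦ norm_proj_le_one i
  -- numerators and denominators
  have hDn : HasFDerivAt (fun y : E3 ↦ Kerr.radius a (E4.ofTimeSpace 0 y) ^ 2 + a ^ 2)
      (((2 : ℕ) • r ^ (2 - 1)) • dr) y := by
    simpa using (hrad.pow 2).add_const (a ^ 2)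
  have hDn' : HasFDerivAt (fun y : E3 ↦ Kerr.radius a (E4.ofTimeSpace 0 y) ^ 2 + a ^ 2)
      ((2 * r) • dr) y := hDn.congr_fderiv (by simp [two_mul, add_smul])
  have hDn0 : r ^ 2 + a ^ 2 ≠ 0 := by positivity
  have hDnn : ‖(2 * r) • dr‖ ≤ 2 * r * q := by
    rw [norm_smul, Real.norm_eq_abs, abs_of_pos (by positivity)]
    exact mul_le_mul_of_nonneg_left hdr (by positivity)
  have hN0 : HasFDerivAt (fun y : E3 ↦ Kerr.radius a (E4.ofTimeSpace 0 y) * y 0 + a * y 1)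
      (r • pr 0 + y 0 • dr + a • pr 1) y :=
    (hrad.fun_mul (hprd 0)).fun_add ((hprd 1).const_mul a)
  have hN1 : HasFDerivAt (fun y : E3 ↦ Kerr.radius a (E4.ofTimeSpace 0 y) * y 1 - a * y 0)
      (r • pr 1 + y 1 • dr - a • pr 0) y :=
    (hrad.fun_mul (hprd 1)).fun_sub ((hprd 0).const_mul a)
  have hsm1 : ∀ i, ‖r • pr i‖ ≤ r := fun i ↦ by
    rw [norm_smul, Real.norm_eq_abs, abs_of_pos hr]
    exact (mul_le_mul_of_nonneg_left (hprn i) hr.le).trans (by rw [mul_one])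
  have hsm2 : ∀ j, ‖y j • dr‖ ≤ q * r * q := fun j ↦ by
    rw [norm_smul, Real.norm_eq_abs]
    exact mul_le_mul (hyi j) hdr (norm_nonneg _) (by positivity)
  have hsm3 : ∀ k, ‖a • pr k‖ ≤ |a| := fun k ↦ by
    rw [norm_smul, Real.norm_eq_abs]
    exact (mul_le_mul_of_nonneg_left (hprn k) (abs_nonneg a)).trans (by rw [mul_one])
  have hNn0 : ‖r • pr 0 + y 0 • dr + a • pr 1‖ ≤ r + q * r * q + |a| :=
    (norm_add_le _ _).trans (add_le_add ((norm_add_le _ _).trans (add_le_add (hsm1 0) (hsm2 0))) (hsm3 1))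
  have hNn1 : ‖r • pr 1 + y 1 • dr - a • pr 0‖ ≤ r + q * r * q + |a| :=
    (norm_sub_le _ _).trans (add_le_add ((norm_add_le _ _).trans (add_le_add (hsm1 1) (hsm2 1))) (hsm3 0))
  have hNval : ∀ i j : Fin 3, |r * y i + a * y j| ≤ q * r * (q * r) ∧ |r * y i - a * y j| ≤ q * r * (q * r) := by
    intro i j
    have h1 : |r * y i| ≤ r * (q * r) := by rw [abs_mul, abs_of_pos hr]; exact mul_le_mul_of_nonneg_left (hyi i) hr.le
    have h2 : |a * y j| ≤ |a| / ρ * r * (q * r) := by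
      rw [abs_mul]; exact mul_le_mul hA (hyi j) (abs_nonneg _) (by positivity)
    have h3 : r * (q * r) + |a| / ρ * r * (q * r) = q * r * (q * r) := by rw [hq_def]; ring
    exact ⟨(abs_add_le _ _).trans (by linarith), (abs_sub _ _).trans (by linarith)⟩
  -- the three components
  obtain ⟨hL0, hL0n⟩ := hasFDerivAt_div_E3 hN0 hDn' hDn0
  obtain ⟨hL1, hL1n⟩ := hasFDerivAt_div_E3 hN1 hDn' hDn0
  obtain ⟨hL2, hL2n⟩ := hasFDerivAt_div_E3 (hprd 2) hrad hr.ne'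
  set L0 := (r ^ 2 + a ^ 2)⁻¹ • (r • pr 0 + y 0 • dr + a • pr 1) -
    ((r * y 0 + a * y 1) / (r ^ 2 + a ^ 2) ^ 2) • ((2 * r) • dr) with hL0_def
  set L1 := (r ^ 2 + a ^ 2)⁻¹ • (r • pr 1 + y 1 • dr - a • pr 0) -
    ((r * y 1 - a * y 0) / (r ^ 2 + a ^ 2) ^ 2) • ((2 * r) • dr) with hL1_def
  set L2 := r⁻¹ • pr 2 - (y 2 / r ^ 2) • dr with hL2_def
  -- bounds for the components
  have hr2 : r ^ 2 ≤ r ^ 2 + a ^ 2 := by nlinarith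
  have hρr : ∀ {x : ℝ}, 0 ≤ x → x / r ≤ x / ρ := fun hx ↦ div_le_div_of_nonneg_left hx hρ hy
  have hbound0 : ∀ (num : ℝ) (N' : E3 →L[ℝ] ℝ), |num| ≤ q * r * (q * r) → ‖N'‖ ≤ r + q * r * q + |a| →
      ‖N'‖ / |r ^ 2 + a ^ 2| + |num| * ‖(2 * r) • dr‖ / (r ^ 2 + a ^ 2) ^ 2 ≤ B0 := by
    intro num N' hnum hN'
    rw [abs_of_pos (by positivity : (0 : ℝ) < r ^ 2 + a ^ 2)]
    have h1 : ‖N'‖ / (r ^ 2 + a ^ 2) ≤ (1 + q * q + q) / ρ := by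
      calc ‖N'‖ / (r ^ 2 + a ^ 2) ≤ (r + q * r * q + |a|) / r ^ 2 := by
            gcongr
          _ ≤ (r + q * r * q + |a| / ρ * r) / r ^ 2 := by gcongr
          _ = (1 + q * q + |a| / ρ) / r := by field_simp
          _ ≤ (1 + q * q + q) / r := by gcongr; linarith
          _ ≤ (1 + q * q + q) / ρ := hρr (by positivity)
    have h2 : |num| * ‖(2 * r) • dr‖ / (r ^ 2 + a ^ 2) ^ 2 ≤ 2 * q ^ 2 * q / ρ := by
      calc |num| * ‖(2 * r) • dr‖ / (r ^ 2 + a ^ 2) ^ 2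
          ≤ q * r * (q * r) * (2 * r * q) / (r ^ 2) ^ 2 := by gcongr
        _ = 2 * q ^ 2 * q / r := by field_simp
        _ ≤ 2 * q ^ 2 * q / ρ := hρr (by positivity)
    calc _ ≤ (1 + q * q + q) / ρ + 2 * q ^ 2 * q / ρ := add_le_add h1 h2
      _ = B0 := by rw [hB0_def]; ring
  have hB0L0 : ‖L0‖ ≤ B0 := hL0n.trans (hbound0 _ _ (hNval 0 1).1 hNn0)
  have hB0L1 : ‖L1‖ ≤ B0 := hL1n.trans (hbound0 _ _ (hNval 1 0).2 hNn1)
  have hB2L2 : ‖L2‖ ≤ B2 := by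
    refine hL2n.trans ?_
    rw [abs_of_pos hr]
    calc ‖pr 2‖ / r + |y 2| * ‖dr‖ / r ^ 2 ≤ 1 / r + r * q / r ^ 2 := by
          gcongr
          · exact hprn 2
          · exact abs_apply_two_le_radius hr
      _ = (q + 1) / r := by field_simp; ring
      _ ≤ B2 := hρr (by positivity)
  -- assemble the `E3`-valued derivative
  set e0 : E3 := EuclideanSpace.single 0 (1 : ℝ) with he0
  set e1 : E3 := EuclideanSpace.single 1 (1 : ℝ) with he1
  set e2 : E3 := EuclideanSpace.single 2 (1 : ℝ) with he2
  set L : E3 →L[ℝ] E3 := L0.smulRight e0 + L1.smulRight e1 + L2.smulRight e2 with hL_def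
  have hLapply : ∀ v : E3, L v = L0 v • e0 + L1 v • e1 + L2 v • e2 := by
    intro v; simp [hL_def]
  refine ⟨L, ?_, ?_⟩
  · rw [← hasFDerivWithinAt_univ, hasFDerivWithinAt_euclidean]
    intro i
    have hcomp : ∀ j : Fin 3, (PiLp.proj 2 (fun _ : Fin 3 ↦ ℝ) j).comp L = ![L0, L1, L2] j := by
      intro j
      ext v
      simp only [ContinuousLinearMap.comp_apply, hLapply, PiLp.proj_apply, PiLp.add_apply,
        PiLp.smul_apply, he0, he1, he2, PiLp.single_apply, smul_eq_mul, mul_ite, mul_one, mul_zero]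
      fin_cases j <;> simp
    rw [hcomp i, hasFDerivWithinAt_univ]
    fin_cases i
    · show HasFDerivAt (fun x : E3 ↦ Kerr.nullSpatial a (E4.ofTimeSpace 0 x) 0) L0 y
      rw [show (fun x : E3 ↦ Kerr.nullSpatial a (E4.ofTimeSpace 0 x) 0) = _ from
        funext (nullSpatial_leaf_apply_zero a)]
      exact hL0
    · show HasFDerivAt (fun x : E3 ↦ Kerr.nullSpatial a (E4.ofTimeSpace 0 x) 1) L1 y
      rw [show (fun x : E3 ↦ Kerr.nullSpatial a (E4.ofTimeSpace 0 x) 1) = _ from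
        funext (nullSpatial_leaf_apply_one a)]
      exact hL1
    · show HasFDerivAt (fun x : E3 ↦ Kerr.nullSpatial a (E4.ofTimeSpace 0 x) 2) L2 y
      rw [show (fun x : E3 ↦ Kerr.nullSpatial a (E4.ofTimeSpace 0 x) 2) = _ from
        funext (nullSpatial_leaf_apply_two a)]
      exact hL2
  · have hn0 : ‖L0.smulRight e0‖ = ‖L0‖ := by
      rw [ContinuousLinearMap.norm_smulRight_apply, he0, PiLp.norm_single, norm_one, mul_one]
    have hn1 : ‖L1.smulRight e1‖ = ‖L1‖ := by
      rw [ContinuousLinearMap.norm_smulRight_apply, he1, PiLp.norm_single, norm_one, mul_one]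
    have hn2 : ‖L2.smulRight e2‖ = ‖L2‖ := by
      rw [ContinuousLinearMap.norm_smulRight_apply, he2, PiLp.norm_single, norm_one, mul_one]
    calc ‖L‖ ≤ ‖L0.smulRight e0 + L1.smulRight e1‖ + ‖L2.smulRight e2‖ := norm_add_le _ _
      _ ≤ ‖L0.smulRight e0‖ + ‖L1.smulRight e1‖ + ‖L2.smulRight e2‖ := by
          gcongr; exact norm_add_le _ _
      _ = ‖L0‖ + ‖L1‖ + ‖L2‖ := by rw [hn0, hn1, hn2]
      _ ≤ B0 + B0 + B2 := by gcongr

/-! ### Exponential decay of the profile and of its differential on the exterior slice -/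

/-- A smooth function on a neighbourhood of the unit sphere is bounded on the sphere together with
its differential (compactness). [folklore] -/
theorem sphere_bounds {𝒮 : E3 → ℂ} {U : Set E3} (hU : IsOpen U) (hsub : sphere (0 : E3) 1 ⊆ U)
    (h𝒮 : ContDiffOn ℝ ∞ 𝒮 U) :
    ∃ A : ℝ, 0 ≤ A ∧ ∀ v ∈ sphere (0 : E3) 1, ‖𝒮 v‖ ≤ A ∧ ‖fderiv ℝ 𝒮 v‖ ≤ A := by
  have hK : IsCompact (sphere (0 : E3) 1) := isCompact_sphere 0 1
  obtain ⟨A1, hA1⟩ := hK.exists_bound_of_continuousOn (h𝒮.continuousOn.mono hsub)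
  obtain ⟨A2, hA2⟩ := hK.exists_bound_of_continuousOn
    ((h𝒮.continuousOn_fderiv_of_isOpen hU (by simp)).mono hsub)
  refine ⟨max (max A1 A2) 0, le_max_right _ _, fun v hv ↦ ⟨?_, ?_⟩⟩
  · exact (hA1 v hv).trans ((le_max_left _ _).trans (le_max_left _ _))
  · exact (hA2 v hv).trans ((le_max_right _ _).trans (le_max_left _ _))

/-- `e^{−κ r(y)} ≤ e^{κ|a|} e^{−κ‖y‖}` on the leaf (`‖y‖ ≤ r + |a|`), `κ ≥ 0`. [folklore] -/
theorem exp_neg_mul_radius_le {a κ : ℝ} (hκ : 0 ≤ κ) {y : E3}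
    (hr : 0 < Kerr.radius a (E4.ofTimeSpace 0 y)) :
    Real.exp (-(κ * Kerr.radius a (E4.ofTimeSpace 0 y))) ≤
      Real.exp (κ * |a|) * Real.exp (-(κ * ‖y‖)) := by
  rw [← Real.exp_add]
  refine Real.exp_le_exp.2 ?_
  have h := norm_le_radius_add_abs hr
  nlinarith

end Literature.Barriers.FinalStateConjecture

end
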